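import Mathlib
import HarnessLib
import Summits.Ventures.LatticeQCDFlow.Scaling.AutoregressiveGaugeAcceptanceCeiling
import Summits.Ventures.LatticeQCDFlow.Scaling.AutoregressiveGaugePlaquetteTVFloorAnyLink

/-!
# LatticeQCDFlow / Scaling — THE ACCEPTANCE CEILING TENDS TO ONE HALF: an exact sampler whose proposal
# generates some gauge link after its staple, from a conditional that ignores the links at one endpoint of
# that link, accepts in equilibrium at most `1 − ½(π_β{‖ρ(U_p) − 1‖ ≤ ε} − Haar{‖ρ(g) − 1‖ ≤ ε})` for every
# `ε` — every compact gauge group, every representation, every dimension, every volume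

HONEST FRAMING: exact (Metropolis-corrected) sampling algorithms for lattice gauge theory;
figures of merit are autocorrelation/cost numbers at stated couplings and volumes; no
continuum-physics claim.

Venture `LatticeQCDFlow` (cell pub-lqcd), topic `Scaling`, FANOUT row 30 (lean-1, GEN-21) — OUR WORK on
THEORY-2.md §4 row C5.  `Scaling/AutoregressiveGaugeAcceptanceCeiling` (gen-19) bounds the equilibrium
acceptance of such a sampler by `1 − ¼⟨(1/N) Re tr U_p⟩_β`, a ceiling tending to `3/4` as `β → ∞`; its engine
`Scaling/AutoregressiveGaugePlaquetteMarginal.wilson_plaquetteMarginal_tv_lower_bound` tests the flat law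
against the one-staple conditional with the observable `Re tr ρ(U_p)` (killed on the flat side by a central
element).  Here the test observable is the INDICATOR OF A SMALL BALL `{‖ρ(U_p) − 1‖ ≤ ε}`: on the flat side a
redrawn closing link makes the holonomy Haar (`integral_comp_plaquetteHolonomy_mul`), so the flat mass of the
ball is the Haar small-ball mass `φ_ρ(ε)`, while on the exact side it is the Wilson probability of the ball,
which tends to `1` at weak coupling.  The sign test function `2·𝟙_ball − 1` then gives the full factor `2`:
the ceiling tends to `½` (for faithful `ρ` on an infinite compact group), and NO central element is needed.

## What is proved (all [ours]; `π = Haar^{⊗E}` on `(ℤ/L)^d`, `L ≥ 2`, continuous `ρ : G → M_N(ℂ)`,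
`F = e^{−βS_W}`, `Z = ∫F dπ`, plaquette `p = (x; k, l)`,
`e` any of the four links of `p`,
`s_H` = the links off the plaquette, `B_ε = {g : ‖ρ(g) − 1‖ ≤ ε}`, `φ_ρ(ε) = Haar(B_ε)`)

* §1 **`wilson_plaquetteMarginal_tv_lower_bound_ball`** — THE ENGINE, for EACH link `e` of `p`:
  `2(∫ 𝟙_{B_ε}(U_p) F dπ − φ_ρ(ε)·Z) ≤ ∫ |A_{s_H}F − A_{insert e s_H}F| dπ` (any `β`, any `ε`);
  **`wilson_condGap_ge_ball_of_mem`** — `s ⊆ s_H`, `q ≥ 0` bounded measurable, normalised in `e`, blind to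
  every other link at an endpoint of `e`: `2(∫ 𝟙_{B_ε}(U_p) F dπ − φ_ρ(ε)·Z) ≤ ∫ |A_sF − q·A_{insert e s}F| dπ`
  (the conditional `L¹` error of the step generating `e` — the input of the KL chain rule, now tending to `2Z`).
* §2 **`wilson_meanAccept_le_of_vertexBlind_ball`** — THE CEILING: a bounded measurable proposal density
  `Q` (`∫Q dπ = 1`) whose conditional at `e` is `q` (`A_sQ = q·A_{insert e s}Q`):
  `ā ≤ 1 − ½((1/Z)∫ 𝟙_{B_ε}(U_p) F dπ − φ_ρ(ε))`.
* (sequel `Scaling/AutoregressiveGaugeAcceptanceCeilingHalfFloor`: Chebyshev turns a plaquette floor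
  `w ≤ ⟨(1/N) Re tr U_p⟩_β` into `(1/Z)∫ 𝟙_{B_ε}(U_p) F ≥ 1 − 2N(1 − w)/ε²`, whence
  `ā ≤ ½ + N(1 − w)/ε² + φ_ρ(ε)/2`, and plugs in the tree's weak-coupling floor.)

READING (value-free): letting `β → ∞` at fixed `ε` and then `ε → 0`, the equilibrium acceptance of every
exact sampler of the stated kind is asymptotically at most `½ + ½·Haar{ρ(g) = 1}` — one half for a faithful
representation of an infinite compact group (`SU(N)`, `U(N)`, `U(1)`), at every volume; the gen-19 ceiling
gave three quarters.  NOT CLAIMED: conditioners reading both endpoints; explicit small-ball masses (they are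
group-specific inputs: upper bounds for `φ_ρ(ε)`, lower bounds for `φ_ρ(r)`); anything beyond the
acceptance.  No `def`, no `sorry`, nothing cited as a fact beyond the tree.
-/

noncomputable section

namespace Summit.Ventures.LatticeQCDFlow.Theory2.Autoregressive

open MeasureTheory Function Set
open Literature.MathematicalPhysics.QuantumFieldTheory Literature.MathematicalPhysics.QuantumLattice
open Summit.Ventures.LatticeQCDFlow.Exactness
open scoped Matrix Matrix.Norms.Frobenius

variable {d L N : ℕ} {G : Type*} [Group G] [TopologicalSpace G] [IsTopologicalGroup G]
  [CompactSpace G] [SecondCountableTopology G] [MeasurableSpace G] [BorelSpace G] [NeZero L]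
  (ρ : G →* Matrix (Fin N) (Fin N) ℂ)

omit [IsTopologicalGroup G] [CompactSpace G] [SecondCountableTopology G] in
/-- The small ball `{g : ‖ρ(g) − 1‖ ≤ ε}` is measurable (closed) for continuous `ρ`. [ours] -/
theorem measurableSet_repBall (hρ : Continuous ρ) (ε : ℝ) :
    MeasurableSet {g : G | ‖ρ g - 1‖ ≤ ε} :=
  (isClosed_le ((hρ.sub continuous_const).norm) continuous_const).measurableSet

/-! ## §1 The engine: the flat law misses the small ball -/

/-- **THE SMALL-BALL ENGINE.**  With `N = A_{s_H}F`, `M = A_{insert a s_H}F` (`s_H` the links off the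
plaquette `p`, `a` its closing link) and `B_ε = {‖ρ(g) − 1‖ ≤ ε}`:
`2(∫ 𝟙_{B_ε}(U_p)·e^{−βS_W} dπ − Haar(B_ε)·Z) ≤ ∫ |N − M| dπ` — test the sign observable `2·𝟙_{B_ε}(U_p) − 1`:
against `N` it integrates like against `F`, against `M` the closing link is redrawn and the holonomy is Haar.
No central element is needed. [ours] -/
theorem wilson_plaquetteMarginal_tv_lower_bound_ball (hρ : Continuous ρ) (hL : 2 ≤ L) (β ε : ℝ)
    (p : Plaquette d L) {e : Edge d L}
    (he : e ∈ ({(p.1, p.2.1.1), (p.1.shift p.2.1.1, p.2.1.2), (p.1.shift p.2.1.2, p.2.1.1), (p.1, p.2.1.2)} :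
      Finset (Edge d L))) :
    2 * (∫ U, Set.indicator {g : G | ‖ρ g - 1‖ ≤ ε} (1 : G → ℝ)
            (plaquetteHolonomy U p.1 p.2.1.1 p.2.1.2) * Real.exp (-β * wilsonAction ρ U)
          ∂Measure.pi (fun _ : Edge d L => haarProbability G) -
        (haarProbability G).real {g : G | ‖ρ g - 1‖ ≤ ε} *
          ∫ U, Real.exp (-β * wilsonAction ρ U) ∂Measure.pi (fun _ : Edge d L => haarProbability G)) ≤
      ∫ U, |coordAvg (haarProbability G)
            (Finset.univ \ {(p.1, p.2.1.1), (p.1.shift p.2.1.1, p.2.1.2), (p.1.shift p.2.1.2, p.2.1.1), (p.1, p.2.1.2)})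
            (fun V : GaugeConfig d L G => Real.exp (-β * wilsonAction ρ V)) U -
          coordAvg (haarProbability G)
            (insert e
              (Finset.univ \ {(p.1, p.2.1.1), (p.1.shift p.2.1.1, p.2.1.2), (p.1.shift p.2.1.2, p.2.1.1), (p.1, p.2.1.2)}))
            (fun V : GaugeConfig d L G => Real.exp (-β * wilsonAction ρ V)) U|
        ∂Measure.pi (fun _ : Edge d L => haarProbability G) := by
  classical
  haveI : Fact (1 < L) := ⟨hL⟩
  set μ := haarProbability G with hμ
  set x := p.1 with hx
  set k := p.2.1.1 with hk
  set l := p.2.1.2 with hl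
  have hkl : k ≠ l := ne_of_lt p.2.2
  set S : Set G := {g : G | ‖ρ g - 1‖ ≤ ε} with hS
  have hSm : MeasurableSet S := measurableSet_repBall ρ hρ ε
  set H : G → ℝ := S.indicator (1 : G → ℝ) with hH
  have hHm : Measurable H := measurable_const.indicator hSm
  have hH01 : ∀ g, 0 ≤ H g ∧ H g ≤ 1 := fun g => by
    by_cases hg : g ∈ S
    · simp [hH, hg]
    · simp [hH, hg]
  set s : Finset (Edge d L) := Finset.univ \ {(x, k), (x.shift k, l), (x.shift l, k), (x, l)} with hs
  set F : GaugeConfig d L G → ℝ := fun V => Real.exp (-β * wilsonAction ρ V) with hF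
  set Nf := coordAvg μ s F with hN'
  set M := coordAvg μ (insert e s) F with hM
  set Z : ℝ := ∫ U, F U ∂Measure.pi (fun _ : Edge d L => μ) with hZ
  obtain ⟨hFm, B, hFlo, hFhi⟩ := wilsonWeight_props (d := d) (L := L) ρ hρ β
  have hFb : ∀ U, |F U| ≤ Real.exp (|β| * B) := fun U => by
    simp only [hF]; rw [abs_of_pos (Real.exp_pos _)]; exact hFhi U
  have hNb : ∀ U, Real.exp (-(|β| * B)) ≤ Nf U ∧ Nf U ≤ Real.exp (|β| * B) := fun U =>
    coordAvg_mem_Icc μ s hFm hFlo hFhi U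
  have hMb : ∀ U, Real.exp (-(|β| * B)) ≤ M U ∧ M U ≤ Real.exp (|β| * B) := fun U =>
    coordAvg_mem_Icc μ (insert e s) hFm hFlo hFhi U
  have hNabs : ∀ U, |Nf U| ≤ Real.exp (|β| * B) := fun U => by
    rw [abs_of_pos (lt_of_lt_of_le (Real.exp_pos _) (hNb U).1)]; exact (hNb U).2
  have hMabs : ∀ U, |M U| ≤ Real.exp (|β| * B) := fun U => by
    rw [abs_of_pos (lt_of_lt_of_le (Real.exp_pos _) (hMb U).1)]; exact (hMb U).2
  have hNm : Measurable Nf := measurable_coordAvg _ s hFm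
  have hMm : Measurable M := measurable_coordAvg _ (insert e s) hFm
  have hMe : ∀ (U : GaugeConfig d L G) (v : G), M (update U e v) = M U := by
    intro U v
    refine coordAvg_congr_off (insert e s) F fun e' he' => ?_
    have : e' ≠ e := fun h => he' (h ▸ Finset.mem_insert_self e s)
    exact update_of_ne this _ _
  -- the test observable `X = 2·𝟙_B(hol_p) − 1`: bounded by `1`, measurable, blind to `s`
  set T : G → ℝ := fun g => 2 * H g - 1 with hT
  have hTm : Measurable T := (hHm.const_mul 2).sub measurable_const
  have hTb : ∀ g : G, |T g| ≤ 1 := fun g => by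
    have := hH01 g
    rw [abs_le]; constructor <;> simp only [hT] <;> linarith [this.1, this.2]
  have hXm : Measurable fun U : GaugeConfig d L G => T (plaquetteHolonomy U x k l) :=
    hTm.comp (measurable_plaquetteHolonomy x k l)
  have hXb : ∀ U : GaugeConfig d L G, |T (plaquetteHolonomy U x k l)| ≤ 1 := fun U => hTb _
  have hn1 : ((x, k) : Edge d L) ∉ s := by simp [hs]
  have hn2 : ((x.shift k, l) : Edge d L) ∉ s := by simp [hs]
  have hn3 : ((x.shift l, k) : Edge d L) ∉ s := by simp [hs]
  have hn4 : ((x, l) : Edge d L) ∉ s := by simp [hs]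
  have hhol_s : ∀ U V : GaugeConfig d L G,
      plaquetteHolonomy (s.piecewise V U) x k l = plaquetteHolonomy U x k l := by
    intro U V
    simp only [plaquetteHolonomy, Finset.piecewise_eq_of_notMem _ _ _ hn1,
      Finset.piecewise_eq_of_notMem _ _ _ hn2, Finset.piecewise_eq_of_notMem _ _ _ hn3,
      Finset.piecewise_eq_of_notMem _ _ _ hn4]
  -- Step 1: `∫ X F = ∫ X N`
  have h1 : ∫ U, T (plaquetteHolonomy U x k l) * F U ∂Measure.pi (fun _ : Edge d L => μ) =
      ∫ U, T (plaquetteHolonomy U x k l) * Nf U ∂Measure.pi (fun _ : Edge d L => μ) :=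
    integral_mul_coordAvg_eq μ s (Φ := fun U => T (plaquetteHolonomy U x k l)) hFm ⟨_, hFb⟩
      hXm ⟨1, fun U => hXb _⟩ (fun U V => by simp only [hhol_s])
  -- Step 2: `∫ X M = (∫ T dHaar)·∫ M = (2 Haar(B) − 1)·Z`
  have hTint : ∫ g, T g ∂(haarProbability G) = 2 * (haarProbability G).real S - 1 := by
    have hHi : Integrable H (haarProbability G) :=
      Integrable.mono' (integrable_const (1 : ℝ)) hHm.aestronglyMeasurable
        (ae_of_all _ fun g => by rw [Real.norm_eq_abs, abs_of_nonneg (hH01 g).1]; exact (hH01 g).2)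
    simp only [hT]
    rw [integral_sub (hHi.const_mul 2) (integrable_const _), integral_const_mul, hH,
      integral_indicator_one hSm]
    simp
  have hMint : ∫ U, M U ∂Measure.pi (fun _ : Edge d L => μ) = Z := by
    rw [hM, hZ]
    exact pi_integral_coordAvg μ (insert e s) hFm hFb
  have h2 : ∫ U, T (plaquetteHolonomy U x k l) * M U ∂Measure.pi (fun _ : Edge d L => μ) =
      (2 * (haarProbability G).real S - 1) * Z := by
    rw [hμ, integral_comp_plaquetteHolonomy_mul_of_mem hL x hkl he hTm hTb hMm hMabs hMe, hTint, ← hμ, hMint]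
  -- Step 3: `∫ X F = 2 ∫ 𝟙_B(hol) F − Z`
  have hHFm : Measurable fun U : GaugeConfig d L G => H (plaquetteHolonomy U x k l) * F U :=
    (hHm.comp (measurable_plaquetteHolonomy x k l)).mul hFm
  have hiHF : Integrable (fun U : GaugeConfig d L G => H (plaquetteHolonomy U x k l) * F U)
      (Measure.pi fun _ : Edge d L => μ) :=
    Integrable.mono' (integrable_const (1 * Real.exp (|β| * B))) hHFm.aestronglyMeasurable
      (ae_of_all _ fun U => by
        rw [Real.norm_eq_abs, abs_mul, abs_of_nonneg (hH01 _).1]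
        exact mul_le_mul (hH01 _).2 (hFb U) (abs_nonneg _) zero_le_one)
  have hiF : Integrable F (Measure.pi fun _ : Edge d L => μ) :=
    Integrable.mono' (integrable_const _) hFm.aestronglyMeasurable
      (ae_of_all _ fun U => by rw [Real.norm_eq_abs]; exact hFb U)
  have h3 : ∫ U, T (plaquetteHolonomy U x k l) * F U ∂Measure.pi (fun _ : Edge d L => μ) =
      2 * ∫ U, H (plaquetteHolonomy U x k l) * F U ∂Measure.pi (fun _ : Edge d L => μ) - Z := by
    have : ∀ U : GaugeConfig d L G, T (plaquetteHolonomy U x k l) * F U =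
        2 * (H (plaquetteHolonomy U x k l) * F U) - F U := fun U => by simp only [hT]; ring
    simp_rw [this]
    rw [integral_sub (hiHF.const_mul 2) hiF, integral_const_mul]
  -- Step 4: `∫ X (N − M) ≤ ∫ |N − M|`
  have hiXN : Integrable (fun U : GaugeConfig d L G => T (plaquetteHolonomy U x k l) * Nf U)
      (Measure.pi fun _ : Edge d L => μ) :=
    Integrable.mono' (integrable_const (1 * Real.exp (|β| * B))) ((hXm.mul hNm).aestronglyMeasurable)
      (ae_of_all _ fun U => by
        rw [Real.norm_eq_abs, abs_mul]
        exact mul_le_mul (hXb _) (hNabs U) (abs_nonneg _) zero_le_one)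
  have hiXM : Integrable (fun U : GaugeConfig d L G => T (plaquetteHolonomy U x k l) * M U)
      (Measure.pi fun _ : Edge d L => μ) :=
    Integrable.mono' (integrable_const (1 * Real.exp (|β| * B))) ((hXm.mul hMm).aestronglyMeasurable)
      (ae_of_all _ fun U => by
        rw [Real.norm_eq_abs, abs_mul]
        exact mul_le_mul (hXb _) (hMabs U) (abs_nonneg _) zero_le_one)
  have hiabs : Integrable (fun U : GaugeConfig d L G => |Nf U - M U|) (Measure.pi fun _ : Edge d L => μ) :=
    (Integrable.mono' (integrable_const _) hNm.aestronglyMeasurable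
        (ae_of_all _ fun U => by rw [Real.norm_eq_abs]; exact hNabs U)).sub
      (Integrable.mono' (integrable_const _) hMm.aestronglyMeasurable
        (ae_of_all _ fun U => by rw [Real.norm_eq_abs]; exact hMabs U)) |>.abs
  have h4 : ∫ U, T (plaquetteHolonomy U x k l) * (Nf U - M U) ∂Measure.pi (fun _ : Edge d L => μ) ≤
      ∫ U, |Nf U - M U| ∂Measure.pi (fun _ : Edge d L => μ) := by
    have hiL : Integrable (fun U : GaugeConfig d L G =>
        T (plaquetteHolonomy U x k l) * (Nf U - M U)) (Measure.pi fun _ : Edge d L => μ) :=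
      (hiXN.sub hiXM).congr (ae_of_all _ fun U => by simp only [Pi.sub_apply]; ring)
    refine integral_mono hiL hiabs fun U => (le_abs_self _).trans ?_
    rw [abs_mul]
    calc |T (plaquetteHolonomy U x k l)| * |Nf U - M U| ≤ 1 * |Nf U - M U| :=
          mul_le_mul_of_nonneg_right (hXb U) (abs_nonneg _)
      _ = |Nf U - M U| := one_mul _
  have h5 : ∫ U, T (plaquetteHolonomy U x k l) * (Nf U - M U) ∂Measure.pi (fun _ : Edge d L => μ) =
      ∫ U, T (plaquetteHolonomy U x k l) * Nf U ∂Measure.pi (fun _ : Edge d L => μ) -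
        ∫ U, T (plaquetteHolonomy U x k l) * M U ∂Measure.pi (fun _ : Edge d L => μ) := by
    rw [← integral_sub hiXN hiXM]
    refine integral_congr_ae (ae_of_all _ fun U => ?_)
    ring
  -- assemble
  have key : ∫ U, T (plaquetteHolonomy U x k l) * (Nf U - M U) ∂Measure.pi (fun _ : Edge d L => μ) =
      2 * (∫ U, H (plaquetteHolonomy U x k l) * F U ∂Measure.pi (fun _ : Edge d L => μ) -
        (haarProbability G).real S * Z) := by
    rw [h5, ← h1, h3, h2]; ring
  rw [← hμ] at key
  simp only [hF] at key
  linarith [key, h4]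


/-- **The conditional `L¹` error at a link generated after the other three links of one of its plaquettes,
from a conditional blind at one of its endpoints, is at least `2(π_β(B_ε) − φ_ρ(ε))·Z`.**  `e` any link of
`p`; `s` a set of links off `p`; `q ≥ 0` bounded measurable, normalised in `e`, blind to every other link at
an endpoint `y` of `e`; any `β`, any `ε`.  Then
`2(∫ 𝟙_{B_ε}(U_p) F dπ − Haar(B_ε)·Z) ≤ ∫ |A_sF − q·A_{insert e s}F| dπ` (`F = e^{−βS_W}`). [ours] -/
theorem wilson_condGap_ge_ball_of_mem (hρ : Continuous ρ) (hL : 2 ≤ L) (β ε : ℝ)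
    (p : Plaquette d L) {e : Edge d L}
    (he : e ∈ ({(p.1, p.2.1.1), (p.1.shift p.2.1.1, p.2.1.2), (p.1.shift p.2.1.2, p.2.1.1), (p.1, p.2.1.2)} :
      Finset (Edge d L)))
    {s : Finset (Edge d L)}
    (hs : s ⊆ Finset.univ \
      {(p.1, p.2.1.1), (p.1.shift p.2.1.1, p.2.1.2), (p.1.shift p.2.1.2, p.2.1.1), (p.1, p.2.1.2)})
    {q : GaugeConfig d L G → ℝ} (hqm : Measurable q) (hq0 : ∀ U, 0 ≤ q U) {Cq : ℝ} (hqb : ∀ U, q U ≤ Cq)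
    (hq1 : ∀ U, ∫ v, q (update U e v) ∂(haarProbability G) = 1)
    {y : Site d L} (hy : e.1 = y ∨ e.1.shift e.2 = y)
    (hqB : ∀ e' : Edge d L, e'.1 = y ∨ e'.1.shift e'.2 = y → e' ≠ e →
      ∀ (U : GaugeConfig d L G) (v : G), q (update U e' v) = q U) :
    2 * (∫ U, Set.indicator {g : G | ‖ρ g - 1‖ ≤ ε} (1 : G → ℝ)
            (plaquetteHolonomy U p.1 p.2.1.1 p.2.1.2) * Real.exp (-β * wilsonAction ρ U)
          ∂Measure.pi (fun _ : Edge d L => haarProbability G) -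
        (haarProbability G).real {g : G | ‖ρ g - 1‖ ≤ ε} *
          ∫ U, Real.exp (-β * wilsonAction ρ U) ∂Measure.pi (fun _ : Edge d L => haarProbability G)) ≤
      ∫ U, |coordAvg (haarProbability G) s (fun V : GaugeConfig d L G => Real.exp (-β * wilsonAction ρ V)) U -
          q U * coordAvg (haarProbability G) (insert e s)
            (fun V : GaugeConfig d L G => Real.exp (-β * wilsonAction ρ V)) U|
        ∂Measure.pi (fun _ : Edge d L => haarProbability G) := by
  classical
  set μ := haarProbability G with hμ
  set F : GaugeConfig d L G → ℝ := fun U => Real.exp (-β * wilsonAction ρ U) with hF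
  set sH : Finset (Edge d L) := Finset.univ \
      {(p.1, p.2.1.1), (p.1.shift p.2.1.1, p.2.1.2), (p.1.shift p.2.1.2, p.2.1.1), (p.1, p.2.1.2)} with hsH
  obtain ⟨hFm, B, hFlo, hFhi⟩ := wilsonWeight_props (d := d) (L := L) ρ hρ β
  have hFabs : ∀ U : GaugeConfig d L G, |F U| ≤ Real.exp (|β| * B) := fun U => by
    rw [abs_of_pos (Real.exp_pos _)]; exact hFhi U
  haveI : Fact (1 < L) := ⟨hL⟩
  have hloop : e.1 ≠ e.1.shift e.2 := fun h => (site_shift_ne hL e.1 e.2) h.symm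
  have hqabs : ∀ U, |q U| ≤ Cq := fun U => by rw [abs_of_nonneg (hq0 U)]; exact hqb U
  -- blind at one endpoint: no better than Haar
  have hV := integral_abs_sub_le_of_vertexBlind s (insert e s) (isGaugeInvariant_wilsonWeightFun ρ β)
    hFm ⟨_, hFabs⟩ hy hloop hqm ⟨Cq, hqabs⟩ hqB hq1
  -- less context, closer to flat
  have heH : e ∉ sH := by
    rw [hsH, Finset.mem_sdiff, not_and, not_not]
    exact fun _ => he
  have hmono := integral_abs_condGap_mono μ hs heH hFm hFabs
  -- the engine, for this link
  have hH := wilson_plaquetteMarginal_tv_lower_bound_ball (d := d) (L := L) ρ hρ hL β ε p he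
  exact hH.trans (hmono.trans hV)

/-! ## §2 The ceiling -/

/-- **THE ACCEPTANCE CEILING `1 − ½(π_β(B_ε) − φ_ρ(ε))`.**  Continuous `ρ`, `L ≥ 2`, any `β`, any `ε`;
plaquette `p`, `e` ANY of its four links (the one generated after the other three); `s` any set of links off
the plaquette; a bounded measurable proposal density `Q` (`∫Q dπ = 1`) whose conditional at `e` is `q`
(`A_sQ = q·A_{insert e s}Q`, `q ≥ 0` bounded measurable, normalised in `e`), `q` blind to every other link at
an endpoint `y` of `e`.  Then `ā ≤ 1 − ½((1/Z)∫ 𝟙_{B_ε}(U_p) e^{−βS_W} dπ − Haar(B_ε))`. [ours] -/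
theorem wilson_meanAccept_le_of_vertexBlind_ball (hρ : Continuous ρ) (hL : 2 ≤ L) (β ε : ℝ)
    (p : Plaquette d L) {e : Edge d L}
    (he : e ∈ ({(p.1, p.2.1.1), (p.1.shift p.2.1.1, p.2.1.2), (p.1.shift p.2.1.2, p.2.1.1), (p.1, p.2.1.2)} :
      Finset (Edge d L)))
    {s : Finset (Edge d L)}
    (hs : s ⊆ Finset.univ \
      {(p.1, p.2.1.1), (p.1.shift p.2.1.1, p.2.1.2), (p.1.shift p.2.1.2, p.2.1.1), (p.1, p.2.1.2)})
    {Q q : GaugeConfig d L G → ℝ} (hQm : Measurable Q) (hQ0 : ∀ U, 0 ≤ Q U) {CQ : ℝ}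
    (hQb : ∀ U, Q U ≤ CQ) (hQ1 : ∫ U, Q U ∂Measure.pi (fun _ : Edge d L => haarProbability G) = 1)
    (hqm : Measurable q) (hq0 : ∀ U, 0 ≤ q U) {Cq : ℝ} (hqb : ∀ U, q U ≤ Cq)
    (hq1 : ∀ U, ∫ v, q (update U e v) ∂(haarProbability G) = 1)
    (hfac : ∀ U, coordAvg (haarProbability G) s Q U =
      q U * coordAvg (haarProbability G) (insert e s) Q U)
    {y : Site d L} (hy : e.1 = y ∨ e.1.shift e.2 = y)
    (hqB : ∀ e' : Edge d L, e'.1 = y ∨ e'.1.shift e'.2 = y → e' ≠ e →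
      ∀ (U : GaugeConfig d L G) (v : G), q (update U e' v) = q U) :
    ∫ U, ∫ V, min
        (Real.exp (-β * wilsonAction ρ U) /
            (∫ W, Real.exp (-β * wilsonAction ρ W) ∂Measure.pi (fun _ : Edge d L => haarProbability G)) *
          Q V)
        (Real.exp (-β * wilsonAction ρ V) /
            (∫ W, Real.exp (-β * wilsonAction ρ W) ∂Measure.pi (fun _ : Edge d L => haarProbability G)) *
          Q U)
        ∂Measure.pi (fun _ : Edge d L => haarProbability G)
        ∂Measure.pi (fun _ : Edge d L => haarProbability G) ≤
      1 - (1 / 2) * ((∫ U, Set.indicator {g : G | ‖ρ g - 1‖ ≤ ε} (1 : G → ℝ)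
            (plaquetteHolonomy U p.1 p.2.1.1 p.2.1.2) * Real.exp (-β * wilsonAction ρ U)
          ∂Measure.pi (fun _ : Edge d L => haarProbability G)) /
          (∫ W, Real.exp (-β * wilsonAction ρ W) ∂Measure.pi (fun _ : Edge d L => haarProbability G)) -
        (haarProbability G).real {g : G | ‖ρ g - 1‖ ≤ ε}) := by
  classical
  set μ := haarProbability G with hμ
  set π := Measure.pi (fun _ : Edge d L => μ) with hπ
  set F : GaugeConfig d L G → ℝ := fun U => Real.exp (-β * wilsonAction ρ U) with hF
  set Z : ℝ := ∫ W, F W ∂π with hZ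
  set I : ℝ := ∫ U, |coordAvg μ s F U - q U * coordAvg μ (insert e s) F U| ∂π with hI
  set Y : ℝ := ∫ U, Set.indicator {g : G | ‖ρ g - 1‖ ≤ ε} (1 : G → ℝ)
      (plaquetteHolonomy U p.1 p.2.1.1 p.2.1.2) * F U ∂π with hY
  set φ : ℝ := (haarProbability G).real {g : G | ‖ρ g - 1‖ ≤ ε} with hφ
  -- the weight
  obtain ⟨hFm, B, hFlo, hFhi⟩ := wilsonWeight_props (d := d) (L := L) ρ hρ β
  have hF0 : ∀ U : GaugeConfig d L G, 0 ≤ F U := fun U => (Real.exp_pos _).le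
  have hZpos : 0 < Z :=
    integral_exp_pos (Literature.Probability.LatticeModels.integrable_of_continuous_compactSpace _
      (Real.continuous_exp.comp (continuous_const.mul (continuous_wilsonAction ρ hρ))))
  -- (1) the acceptance form
  have hacc := meanAccept_le_of_condProposal μ s hFm hF0 hFhi hZpos hQm hQ0 hQb hQ1 hqm hq0 hqb hq1 hfac
  -- (2)–(4) the conditional-error floor at `e`
  have hXle : 2 * (Y - φ * Z) ≤ I :=
    wilson_condGap_ge_ball_of_mem (d := d) (L := L) ρ hρ hL β ε p he hs hqm hq0 hqb hq1 hy hqB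
  have hkey : (1 / 2 : ℝ) * (Y / Z - φ) ≤ 1 / (4 * Z) * I := by
    have e1 : (1 / 2 : ℝ) * (Y / Z - φ) = 1 / (4 * Z) * (2 * (Y - φ * Z)) := by
      field_simp
      ring
    rw [e1]
    exact mul_le_mul_of_nonneg_left hXle (by positivity)
  linarith

end Summit.Ventures.LatticeQCDFlow.Theory2.Autoregressive

end
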